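/-
Copyright (c) 2026. All rights reserved.
Released under Apache 2.0 license as described in the file LICENSE.
Authors: abc-iut cell, prover seat abc-iut-w6-d031 (gen 5; PROOF-ONLY: the anharmonic transformation
law of the modular function `λ` under `SL₂(ℤ)`, UNIFORM in the point — input of the parabolic case of
the great Picard theorem via `λ`).
-/
import Literature.NumberTheory.Automorphic.ModularLambdaCovering
import HarnessLib

/-!
# `λ ∘ g = φ_g ∘ λ` for `g ∈ SL₂(ℤ)`: the anharmonic transformation law, uniform in `z`

F. Calegari, V. Dimitrov, Y. Tang, *The unbounded denominators conjecture*, J. Amer. Math. Soc. 38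
(2025), §1 p. 3 (`SL₂(ℤ)/Γ(2) ≅ SL₂(𝔽₂) ≅ S₃` acts on `Y(2) ≅ ℙ¹ ∖ {0, 1, ∞}` through the anharmonic
group); classical (L. V. Ahlfors, *Complex Analysis* (1979), Ch. 7 §3.4).  The tree's
`ModularLambda.modularLambda_smul_eq_or` / `mem_Gamma_two_or_modularLambda_smul_eq` give, for EACH
`z ∈ ℍ` separately, that `λ(g • z)` is one of the six anharmonic transforms of `λ(z)`.  This PROOF-ONLY
file (no definitions, no named facts) proves the UNIFORM statement — the SAME transform for all `z`,
determined by the class of `g` in `SL₂(ℤ/2)`: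

* ★ `ModularLambda.modularLambda_smul_eq_or_forall` — for every `g ∈ SL₂(ℤ)`, ONE of
  `∀ z, λ(g • z) = λ z`, `∀ z, λ(g • z) = 1 − λ z`, `∀ z, λ(g • z) = (λ z)⁻¹`,
  `∀ z, λ(g • z) = (1 − λ z)⁻¹`, `∀ z, λ(g • z) = 1 − (λ z)⁻¹`, `∀ z, λ(g • z) = 1 − (1 − λ z)⁻¹` holds
  (reduction mod `2`: `g ≡ R` for `R ∈ {1, S, T, TS, ST, STS}` by the tree's `sl2_zmod_two_cases`,
  `g R⁻¹ ∈ Γ(2)` acts trivially on `λ` by `modularLambda_smul`, and `λ ∘ R` is computed from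
  `modularLambda_S_smul`, `modularLambda_T_smul` of `ModularLambdaSurjective`).

## References

* [CalegariDimitrovTang2025] F. Calegari, V. Dimitrov, Y. Tang, The unbounded denominators conjecture,
  J. Amer. Math. Soc. 38 (2025), §1 p. 3.
* L. V. Ahlfors, *Complex Analysis*, 3rd ed. (1979), Ch. 7 §3.4. [Ahlfors1979]
-/

set_option autoImplicit false

noncomputable section

open Complex UpperHalfPlane ModularGroup CongruenceSubgroup Matrix.SpecialLinearGroup
open Filter Topology Metric Bornology

open scoped MatrixGroups ModularForm

namespace Literature.NumberTheory.Automorphic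

namespace ModularLambda

/-- For `g ≡ R (mod Γ(2))`, `λ(g • z) = λ(R • z)` for all `z`. [cite: CalegariDimitrovTang2025, §1 p. 3] -/
theorem modularLambda_smul_eq_of_map_eq {g R : SL(2, ℤ)}
    (h : Matrix.SpecialLinearGroup.map (Int.castRingHom (ZMod 2)) g =
      Matrix.SpecialLinearGroup.map (Int.castRingHom (ZMod 2)) R) (z : ℍ) :
    modularLambda ((g • z : ℍ) : ℂ) = modularLambda ((R • z : ℍ) : ℂ) := by
  have hmem : g * R⁻¹ ∈ CongruenceSubgroup.Gamma 2 := by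
    rw [CongruenceSubgroup.Gamma_mem', map_mul, map_inv, h, mul_inv_cancel]
  have := modularLambda_smul hmem (R • z)
  rw [smul_smul, inv_mul_cancel_right] at this
  exact this

/-- ★ **The anharmonic transformation law, uniform in `z`.**  For every `g ∈ SL₂(ℤ)` exactly one of the
six anharmonic transforms `φ` (namely `λ`, `1 − λ`, `λ⁻¹`, `(1 − λ)⁻¹`, `1 − λ⁻¹`, `1 − (1 − λ)⁻¹`)
satisfies `λ(g • z) = φ(λ(z))` for ALL `z ∈ ℍ` — according to the class of `g` in
`SL₂(ℤ)/Γ(2) ≅ SL₂(ℤ/2) ≅ S₃`. [cite: CalegariDimitrovTang2025, §1 p. 3] [cite: Ahlfors1979, Ch. 7 §3.4] -/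
theorem modularLambda_smul_eq_or_forall (g : SL(2, ℤ)) :
    (∀ z : ℍ, modularLambda ((g • z : ℍ) : ℂ) = modularLambda z) ∨
    (∀ z : ℍ, modularLambda ((g • z : ℍ) : ℂ) = 1 - modularLambda z) ∨
    (∀ z : ℍ, modularLambda ((g • z : ℍ) : ℂ) = (modularLambda z)⁻¹) ∨
    (∀ z : ℍ, modularLambda ((g • z : ℍ) : ℂ) = (1 - modularLambda z)⁻¹) ∨
    (∀ z : ℍ, modularLambda ((g • z : ℍ) : ℂ) = 1 - (modularLambda z)⁻¹) ∨
    (∀ z : ℍ, modularLambda ((g • z : ℍ) : ℂ) = 1 - (1 - modularLambda z)⁻¹) := by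
  rcases sl2_zmod_two_cases (Matrix.SpecialLinearGroup.map (Int.castRingHom (ZMod 2)) g) with
    h | h | h | h | h | h
  · -- `g ∈ Γ(2)`
    refine Or.inl fun z => ?_
    have h1 : Matrix.SpecialLinearGroup.map (Int.castRingHom (ZMod 2)) g =
        Matrix.SpecialLinearGroup.map (Int.castRingHom (ZMod 2)) 1 := by rw [h, map_one]
    rw [modularLambda_smul_eq_of_map_eq h1, one_smul]
  · -- `g ≡ S`: `1 − λ`
    refine Or.inr (Or.inl fun z => ?_)
    rw [modularLambda_smul_eq_of_map_eq h, modularLambda_S_smul]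
  · -- `g ≡ T`: `1 − (1 − λ)⁻¹`
    refine Or.inr (Or.inr (Or.inr (Or.inr (Or.inr fun z => ?_))))
    rw [modularLambda_smul_eq_of_map_eq h, modularLambda_T_smul]
  · -- `g ≡ TS`: `λ(T • S • z) = 1 − (1 − (1 − λ))⁻¹ = 1 − λ⁻¹`
    refine Or.inr (Or.inr (Or.inr (Or.inr (Or.inl fun z => ?_))))
    rw [modularLambda_smul_eq_of_map_eq h, mul_smul, modularLambda_T_smul, modularLambda_S_smul,
      sub_sub_cancel]
  · -- `g ≡ ST`: `λ(S • T • z) = 1 − (1 − (1 − λ)⁻¹) = (1 − λ)⁻¹`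
    refine Or.inr (Or.inr (Or.inr (Or.inl fun z => ?_)))
    rw [modularLambda_smul_eq_of_map_eq h, mul_smul, modularLambda_S_smul, modularLambda_T_smul,
      sub_sub_cancel]
  · -- `g ≡ STS`: `λ(S • T • S • z) = 1 − (1 − (1 − (1 − λ))⁻¹) = λ⁻¹`
    refine Or.inr (Or.inr (Or.inl fun z => ?_))
    rw [modularLambda_smul_eq_of_map_eq h, mul_smul, mul_smul, modularLambda_S_smul,
      modularLambda_T_smul, modularLambda_S_smul, sub_sub_cancel, sub_sub_cancel]

/-- **The anharmonic transforms send `0` to `{0, 1, ∞}`**, recorded as the limit behaviour used by the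
great Picard theorem: along any filter on which `λ(z) → 0`, `λ(g • z)` tends to `0`, to `1`, or to
`∞` (`Filter.cocompact ℂ`). [cite: CalegariDimitrovTang2025, §1 p. 3] [cite: Ahlfors1979, Ch. 7 §3.4] -/
theorem tendsto_modularLambda_smul_of_tendsto_zero (g : SL(2, ℤ)) {ι : Type*} {l : Filter ι}
    {z : ι → ℍ} (hz : Filter.Tendsto (fun i => modularLambda (z i : ℂ)) l (nhds 0)) :
    Filter.Tendsto (fun i => modularLambda ((g • z i : ℍ) : ℂ)) l (nhds 0) ∨
    Filter.Tendsto (fun i => modularLambda ((g • z i : ℍ) : ℂ)) l (nhds 1) ∨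
    Filter.Tendsto (fun i => modularLambda ((g • z i : ℍ) : ℂ)) l (Filter.cocompact ℂ) := by
  have hne : ∀ i, modularLambda (z i : ℂ) ≠ 0 := fun i => modularLambda_ne_zero (z i).2
  have hne1 : ∀ i, (1 : ℂ) - modularLambda (z i : ℂ) ≠ 0 := fun i =>
    sub_ne_zero.mpr (modularLambda_ne_one (z i).2).symm
  -- `λ⁻¹ → ∞` and `(1 - λ)⁻¹ → 1`, `1 - (1 - λ)⁻¹ → 0`, `1 - λ⁻¹ → ∞`
  have hinv : Filter.Tendsto (fun i => (modularLambda (z i : ℂ))⁻¹) l (Filter.cocompact ℂ) := by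
    rw [← cobounded_eq_cocompact, ← tendsto_norm_atTop_iff_cobounded]
    have h1 : Filter.Tendsto (fun i => ‖modularLambda (z i : ℂ)‖) l (nhdsWithin 0 (Set.Ioi 0)) := by
      refine tendsto_nhdsWithin_iff.mpr ⟨?_, Filter.Eventually.of_forall fun i => norm_pos_iff.mpr (hne i)⟩
      simpa using hz.norm
    have h2 := Filter.Tendsto.comp tendsto_inv_nhdsGT_zero h1
    refine h2.congr fun i => ?_
    simp [norm_inv]
  have h1sub : Filter.Tendsto (fun i => (1 : ℂ) - modularLambda (z i : ℂ)) l (nhds 1) := by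
    simpa using (tendsto_const_nhds (x := (1 : ℂ))).sub hz
  rcases modularLambda_smul_eq_or_forall g with h | h | h | h | h | h <;> simp_rw [h]
  · exact Or.inl hz
  · exact Or.inr (Or.inl (by simpa using (tendsto_const_nhds (x := (1 : ℂ))).sub hz))
  · exact Or.inr (Or.inr hinv)
  · refine Or.inr (Or.inl ?_)
    simpa using h1sub.inv₀ one_ne_zero
  · refine Or.inr (Or.inr ?_)
    -- `1 - λ⁻¹ → ∞`
    rw [← cobounded_eq_cocompact, ← tendsto_norm_atTop_iff_cobounded] at hinv ⊢
    have : Filter.Tendsto (fun i => ‖(modularLambda (z i : ℂ))⁻¹‖ + -‖(1 : ℂ)‖) l Filter.atTop :=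
      Filter.tendsto_atTop_add_const_right _ _ hinv
    refine Filter.tendsto_atTop_mono (fun i => ?_) this
    have := norm_sub_norm_le (modularLambda (z i : ℂ))⁻¹ (1 : ℂ)
    have h' : ‖(modularLambda (z i : ℂ))⁻¹ - 1‖ = ‖1 - (modularLambda (z i : ℂ))⁻¹‖ := norm_sub_rev _ _
    linarith
  · refine Or.inl ?_
    simpa using (tendsto_const_nhds (x := (1 : ℂ))).sub (h1sub.inv₀ one_ne_zero)

end ModularLambda

end Literature.NumberTheory.Automorphic

end
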